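import Summits.BirchSwinnertonDyer.BirchSwinnertonDyer.Theorems.SchneiderFreeAdditiveX3LeafContentWindow
import Summits.BirchSwinnertonDyer.Rank1Residual.Additive.QuadraticTwistBSDComparisonIsogeny
import HarnessLib

/-!
# Route `SchneiderFreeAdditiveX3` (K1 door): the content window READ ON THE ISOGENY CLASS — the leaf's body at a pair is
# free as soon as SOME globally minimal `ℚ`-isogenous member has `p ∤ #Ш_an` (Cassels transport); the branch cruxes are
# consumed only at the pairs whose WHOLE class has `p ∣ #Ш_an`

Cell `bsd-schneider-ideate`, seat `bsd-schneider-door-c5` (prover, generation 38; `--supports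
stmt-BirchSwinnertonDyer-19177 --as helper`).  Sequel of `…LeafContentWindow.lean` (F35: the rung leaf from `PrintedFacts` + per pair
[`#Ш_an(E)` a `p`-adic unit (free) ∨ one STEP-L datum]).  On X3 a rational `p`-isogeny moves `p`-powers between `#Ш_an`, `∏c_ℓ` and
`#E(ℚ)_tors²` inside the class, so the unit literal `p ∤ #Ш_an` is NOT a class invariant while the leaf's body `MissingLowerBoundAt` IS
(Cassels 1965: the BSD quotient is an isogeny invariant; the b2b cell's `TwistComparison.missingLowerBoundAt_of_isIsogenous`, from the
`PrintedFacts` conjuncts Cassels `bsdRHS_eq_of_isIsogenous`, GZK, modularity).  CENSUS (this generation, kit j336724 «shawin» + j336756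
«win9», HOME memos/census-door-c5-g38/): on the door's 7 101 pairs `#Ш_an(E₁) ∈ {1, 4, 9}`; the content window of F35 is the 9 classes with
`#Ш_an(E₁) = 9` (all `p = 3`: Gord3 215118bd, 196794ci, 491985u; M 155610c, 235620bk, 335331f, 412794t, 459684b, 492660bw), and in EACH of them
the `3`-isogenous member has `#Ш_an = 1` (the `9` moves into `∏c_ℓ`/torsion: e.g. 215118bd `∏c = 1 → 27`, `#tors = 1 → 3`) — independently the
b2b cell's finding (team n1011 seat p16, `Rank1Residual/Additive/RankOneUpperHalfUnitRowsIsogeny.lean`).  Hence, per census pair, the K1 rung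
leaf's instance holds at ALL 7 101 pairs from `PrintedFacts` and the class's `Ш_an` column; the branch cruxes r2 `PotMultBranchIMC` / r3
`GordTwoBranchIMC` are consumed by NO census pair — the door's content is the CLASS-WIDE theorem alone.

* §1 `missingLowerBoundAt_of_printedFacts_of_shaAn_window_of_isIsogenous` — the leaf's body at `(W, p)` from `PrintedFacts` and a globally
  minimal `W₀ ∼ W` of analytic rank `≤ 1` with `#Ш_an(W₀) = q`, `ord_p q ≤ 0`.
* §2 `additiveX3RankOneLower_of_printedFacts_of_classWindow_or_stepL` — the leaf ⟸ `PrintedFacts` + per pair [such a `W₀` ∨ one STEP-L datum].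

HONEST FRAMING.  CONDITIONAL on `PrintedFacts`; the per-pair data are hypotheses (census values are evidence, Cremona/Gross–Zagier numerics to 1e-35);
the class-wide leaf, the cruxes and the target are untouched; no item closes; BSD is proved for no curve.
References: Cassels 1965 / Milne ADT I.7.3 [MilneADT2006]; Miller 2011 §1, Def. 1.1 [Miller2011LMS]; this route p749157 (F35), p748362 (F32).
-/

set_option autoImplicit false
-- `Summit.<P>.<Sub>` repeats `BirchSwinnertonDyer` by the tree's layout convention (D-0017)
set_option linter.dupNamespace false

noncomputable section

open scoped Classical

open Field NumberField IsDedekindDomain WeierstrassCurve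
open Literature.NumberTheory.EllipticCurves Literature.NumberTheory.EllipticCurves.ModularForms
  Literature.NumberTheory.EllipticCurves.Rank1Residual Literature.NumberTheory.EllipticCurves.Rank1Residual.Typed
  Summit.BirchSwinnertonDyer.Rank1Residual Summit.BirchSwinnertonDyer.Rank1Residual.X11b
  Summit.BirchSwinnertonDyer.BirchSwinnertonDyer.Theorems.SchneiderFree
  Summit.BirchSwinnertonDyer.BirchSwinnertonDyer.Theses.SchneiderFreeAdditiveX3

namespace Summit.BirchSwinnertonDyer.BirchSwinnertonDyer.Theorems.SchneiderFreeAdditiveX3.LeafIndexRegime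

/-! ### §1 The window at an isogenous member -/

/-- **The leaf's body at `(W, p)` from `PrintedFacts` and an ISOGENOUS member off the window.**  If `W₀ ∼ W` (both globally minimal, over `ℚ`)
has analytic rank `≤ 1` and `#Ш_an(W₀) = q ∈ ℚ` with `ord_p q ≤ 0`, then `MissingLowerBoundAt W p`: the body is free at `W₀` (b2b's window lemma)
and transports along the isogeny (Cassels' invariance of the BSD quotient `bsdRHS_eq_of_isIsogenous`, GZK, modularity — conjuncts of
`PrintedFacts`).  CONDITIONAL on `PrintedFacts`. [cite: MilneADT2006, Thm. I.7.3] [cite: Miller2011LMS, §1 and Def. 1.1] -/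
theorem missingLowerBoundAt_of_printedFacts_of_shaAn_window_of_isIsogenous (hF : PrintedFacts)
    (W : WeierstrassCurve ℚ) [W.IsElliptic] [W.IsGloballyMinimal] (p : ℕ) [Fact p.Prime]
    (W₀ : WeierstrassCurve ℚ) [W₀.IsElliptic] [W₀.IsGloballyMinimal] (hiso : IsIsogenous W₀ W) (hr₀ : W₀.analyticRank ≤ 1)
    {q : ℚ} (hq : shaAn W₀ = (q : ℂ)) (hv : padicValRat p q ≤ 0) :
    MissingLowerBoundAt W p :=
  Additive.TwistComparison.missingLowerBoundAt_of_isIsogenous W₀ W p hF.2.2.2.2.2.1 hF.2.2.1 hF.2.2.2.1 hiso hr₀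
    (Additive.N10.missingLowerBoundAt_of_padicValRat_le_zero W₀ p hq hv)

/-! ### §2 The class-window form of the leaf chain -/

/-- **The rung leaf from `PrintedFacts`, asking STEP L only at the pairs whose WHOLE isogeny class lies on the window.**  For every pair of the
door: either some globally minimal `ℚ`-isogenous `W₀` of analytic rank `≤ 1` has `#Ш_an(W₀) = q` with `ord_p q ≤ 0` (then the body is free, §1),
or a Heegner datum of the door with STEP L is supplied.  Census (this generation): on the 7 101 pairs of record the first disjunct holds at every
pair (7 092 at `W₀ = W`, 9 at the `3`-isogenous member) — evidence, not asserted.  CONDITIONAL on `PrintedFacts`.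
[cite: MilneADT2006, Thm. I.7.3] [cite: Miller2011LMS, Def. 1.1] [cite: JetchevSkinnerWan2017, §7.4.1 (arXiv:1512.06894 p. 30)] -/
theorem additiveX3RankOneLower_of_printedFacts_of_classWindow_or_stepL (hF : PrintedFacts)
    (hWL : ∀ (W : WeierstrassCurve ℚ) [W.IsElliptic] [W.IsGloballyMinimal] (p : ℕ) [Fact p.Prime],
      W.analyticRank = 1 → p ≠ 2 → ClassX3 W p → Additive.SubSemistableTwist W p →
      (∃ (W₀ : WeierstrassCurve ℚ) (_ : W₀.IsElliptic) (_ : W₀.IsGloballyMinimal) (q : ℚ),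
          IsIsogenous W₀ W ∧ W₀.analyticRank ≤ 1 ∧ shaAn W₀ = (q : ℂ) ∧ padicValRat p q ≤ 0) ∨
      (∃ (N : ℕ) (_ : NeZero N) (K : Type) (_ : Field K) (_ : NumberField K)
        (Dt : ModularParametrizationData W N) (H : HeegnerDatum N (NumberField.discr K)) (ι : K →+* ℂ)
        (P : (W.baseChange K).toAffine.Point),
        W.conductorNorm ℤ = N ∧ IsImaginaryQuadratic K ∧ Odd (NumberField.discr K) ∧
        ¬ p ∣ Units.torsionOrder K ∧ SatisfiesHeegnerHypothesis N K ∧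
        (W.quadraticTwist (NumberField.discr K : ℚ)).entireLFunction 1 ≠ 0 ∧
        WeierstrassCurve.Affine.Point.map ι.toRatAlgHom P = heegnerPointComplex Dt H ∧
        ¬ IsOfFinAddOrder P ∧ IndexLowerBoundLeAt W p K P (padicValNat p Dt.c.natAbs))) :
    Summit.BirchSwinnertonDyer.BirchSwinnertonDyer.Theorems.SchneiderFree.AdditiveX3RankOneLower := by
  intro W _ _ p _ hr hp2 hX hS
  rcases hWL W p hr hp2 hX hS with ⟨W₀, _, _, q, hiso, hr₀, hq, hv⟩ |
      ⟨N, _, K, _, _, Dt, H, ι, P, hN, hK, hodd, hunit, hHe, hLt, hP, hnt, hidx⟩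
  · exact missingLowerBoundAt_of_printedFacts_of_shaAn_window_of_isIsogenous hF W p W₀ hiso hr₀ hq hv
  · exact missingLowerBoundAt_of_printedFacts_of_indexLowerBoundLeAt hF W p hr hp2 hX hS N K Dt H ι P hN hK hodd hunit
      hHe hLt hP hnt hidx

end Summit.BirchSwinnertonDyer.BirchSwinnertonDyer.Theorems.SchneiderFreeAdditiveX3.LeafIndexRegime

end
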